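import Summits.CriticalPhenomena.PercolationContinuityZ3.Theorems.PercNearOneGluingNoHeavyLowerTailAntipodalR1TwoCut
import HarnessLib

/-!
# ANTI₁ across a 2-separation, V: the contraction form of the third hypothesis

Support file for `stmt-CriticalPhenomena-4575` (memo `prim-gen-kcluster/KCLUSTER-gen76.md` §2;
conjecture ANTI₁ of `KCLUSTER-gen52.md` §3).  No definitions, no named facts, no sorries.  Vocabulary of
`AntipodalR1` (`nbr`, `clus`, `freeNbr`, `region`, `lSet`, `rSet`; gen 62) and parts I–III (gen 78).

The 2-cut reduction `card_lSet_le_card_rSet_of_twoCut` (part III) asks, as its third hypothesis, for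
ANTI₁ on the colourings `ω₁ ⊕ id` of `G₁ + e_O + e_K` (`Sum.elim ends₁ (fun _ : Bool => s(u, v))`, the
edge `inr col` carrying colour `col`).  Here we identify that fibre with ANTI₁ for the CONTRACTION
`G₁ / uv`: the system `fun i => (ends₁ i).map π` with `π w = if w = v then u else w` (the vertex `v`
survives as an isolated vertex), apex `π a` and terminals `π b`, `π c`:
* `mem_clus_pair_iff` — `x ∈ clus_{col}(a)` in `G₁ + e_O + e_K` iff `π x ∈ clus_{col}(π a)` in `G₁ / uv`;
* `region_pair_of_region_contract`, `region_contract_of_region_pair` — regions correspond likewise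
  (given `b ∉ K_a`);
* `filter_lSet_pair_eq_lSet_contract`, `filter_rSet_pair_eq_rSet_contract` — the fibres ARE the two
  sides of ANTI₁ for the contraction;
* **`card_lSet_le_card_rSet_of_twoCut'`** — the 2-cut reduction with hypotheses ANTI₁(`G₁`),
  ANTI₁(`G₁ + uv`), ANTI₁(`G₁ / uv`), literally as in the memo.  Since all three have fewer edges than
  `G` as soon as `G₂` has at least two edges, a counterexample to ANTI₁ with the fewest edges has no
  2-separation `{u, v}` with `a, b, c` on one side and ≥ 2 edges on the other: it is simple (no parallel
  pair), has no non-terminal vertex of degree 2, and no terminal-free side of a 2-separator.  [this work]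
-/

namespace Summit.CriticalPhenomena.PercolationContinuityZ3.Theorems

namespace AntipodalR1

open Finset Relation

variable {V ι₁ : Type*} [DecidableEq V]

section Contract

variable {ends₁ : ι₁ → Sym2 V} {u v a : V} {ω₁ : ι₁ → Bool}

/-- Fibres of the projection `π w = if w = v then u else w`: `π x = π y` iff `x = y` or
`{x, y} = {u, v}`. [this work] -/
theorem proj_eq_iff {x y : V} :
    (if x = v then u else x) = (if y = v then u else y) ↔
      x = y ∨ (x = u ∧ y = v) ∨ (x = v ∧ y = u) := by
  by_cases hx : x = v <;> by_cases hy : y = v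
  · rw [if_pos hx, if_pos hy]
    exact ⟨fun _ => Or.inl (hx.trans hy.symm), fun _ => rfl⟩
  · rw [if_pos hx, if_neg hy]
    constructor
    · exact fun h => Or.inr (Or.inr ⟨hx, h.symm⟩)
    · rintro (h | ⟨-, h⟩ | ⟨-, h⟩)
      · exact (hy (h ▸ hx)).elim
      · exact (hy h).elim
      · exact h.symm
  · rw [if_neg hx, if_pos hy]
    constructor
    · exact fun h => Or.inr (Or.inl ⟨h, hy⟩)
    · rintro (h | ⟨h, -⟩ | ⟨h, -⟩)
      · exact (hx (h.trans hy)).elim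
      · exact h
      · exact (hx h).elim
  · rw [if_neg hx, if_neg hy]
    constructor
    · exact fun h => Or.inl h
    · rintro (h | ⟨-, h⟩ | ⟨h, -⟩)
      · exact h
      · exact (hy h).elim
      · exact (hx h).elim

omit [DecidableEq V] in
/-- In `G₁ + e_O + e_K` the two ends of the gadget are joined in both colours: a cluster containing one
of `u, v` contains the other. [this work] -/
theorem mem_clus_pair_of_partner {col : Bool} {x y : V}
    (hx : x ∈ clus (Sum.elim ends₁ (fun _ : Bool => s(u, v))) (Sum.elim ω₁ id) col a)
    (hxy : (x = u ∧ y = v) ∨ (x = v ∧ y = u)) :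
    y ∈ clus (Sum.elim ends₁ (fun _ : Bool => s(u, v))) (Sum.elim ω₁ id) col a := by
  refine clus_step hx ⟨Sum.inr col, rfl, ?_⟩
  rcases hxy with ⟨rfl, rfl⟩ | ⟨rfl, rfl⟩
  · rfl
  · exact Sym2.eq_swap

/-- **Clusters of `G₁ + e_O + e_K` versus `G₁ / uv`.** [this work] -/
theorem mem_clus_pair_iff {col : Bool} {x : V} :
    x ∈ clus (Sum.elim ends₁ (fun _ : Bool => s(u, v))) (Sum.elim ω₁ id) col a ↔
      (if x = v then u else x) ∈ clus (fun i => (ends₁ i).map fun w => if w = v then u else w) ω₁ col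
        (if a = v then u else a) := by
  constructor
  · intro hx
    rw [mem_clus] at hx ⊢
    induction hx with
    | refl => exact ReflTransGen.refl
    | @tail p q _ hpq ih =>
      rcases mem_nbr_sum_elim.1 hpq with ⟨i, hi, he⟩ | ⟨k, _, he⟩
      · have he' : ends₁ i = s(p, q) := he
        exact ih.tail ⟨i, hi, by simp only [he', Sym2.map_mk]⟩
      · have he' : s(u, v) = s(p, q) := he
        have hpq' : (if p = v then u else p) = (if q = v then u else q) := by
          rcases Sym2.eq_iff.1 he' with ⟨rfl, rfl⟩ | ⟨rfl, rfl⟩ <;> simp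
        rw [← hpq']
        exact ih
  · intro hx
    rw [mem_clus] at hx
    suffices h : ∀ y, ReflTransGen (fun p q => q ∈ nbr (fun i => (ends₁ i).map fun w =>
        if w = v then u else w) ω₁ col p) (if a = v then u else a) y →
        ∀ x, (if x = v then u else x) = y →
          x ∈ clus (Sum.elim ends₁ (fun _ : Bool => s(u, v))) (Sum.elim ω₁ id) col a from
      h _ hx x rfl
    intro y hy
    induction hy with
    | refl =>
      intro x hx
      rcases proj_eq_iff.1 hx with rfl | hxy
      · exact ReflTransGen.refl
      · exact mem_clus_pair_of_partner ReflTransGen.refl (hxy.symm.imp And.symm And.symm)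
    | @tail y z _ hyz ih =>
      intro x hx
      obtain ⟨i, hi, he⟩ := hyz
      -- write `ends₁ i = s(p', q')`; one of `p', q'` projects to `y`, the other to `z`
      obtain ⟨p', q', hE⟩ : ∃ p' q', ends₁ i = s(p', q') :=
        Sym2.ind (fun p q => ⟨p, q, rfl⟩) (ends₁ i)
      have he' : s(if p' = v then u else p', if q' = v then u else q') = s(y, z) := by
        rw [← Sym2.map_mk (fun w => if w = v then u else w), ← hE]; exact he
      have key : ∀ p' q', ends₁ i = s(p', q') → (if p' = v then u else p') = y →
          (if q' = v then u else q') = z →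
          x ∈ clus (Sum.elim ends₁ (fun _ : Bool => s(u, v))) (Sum.elim ω₁ id) col a := by
        intro p' q' hE hp' hq'
        have hp : p' ∈ clus (Sum.elim ends₁ (fun _ : Bool => s(u, v))) (Sum.elim ω₁ id) col a :=
          ih p' hp'
        have hq : q' ∈ clus (Sum.elim ends₁ (fun _ : Bool => s(u, v))) (Sum.elim ω₁ id) col a :=
          clus_step hp ⟨Sum.inl i, hi, hE⟩
        rcases proj_eq_iff.1 (hq'.trans hx.symm) with rfl | hxy
        · exact hq
        · exact mem_clus_pair_of_partner hq hxy
      rcases Sym2.eq_iff.1 he' with ⟨h1, h2⟩ | ⟨h1, h2⟩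
      · exact key p' q' hE h1 h2
      · exact key q' p' (hE.trans Sym2.eq_swap) h2 h1

/-- **Regions, forward.**  A support path of `G₁ + e_O + e_K` from `b` avoiding `K_a` projects to a
support path of `G₁ / uv` from `π b` avoiding `K_{π a}`. [this work] -/
theorem region_contract_of_region_pair {b x : V}
    (hx : x ∈ region (Sum.elim ends₁ (fun _ : Bool => s(u, v))) (Sum.elim ω₁ id) a b) :
    (if x = v then u else x) ∈ region (fun i => (ends₁ i).map fun w => if w = v then u else w) ω₁
      (if a = v then u else a) (if b = v then u else b) := by
  rw [mem_region] at hx ⊢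
  induction hx with
  | refl => exact ReflTransGen.refl
  | @tail p q _ hpq ih =>
    obtain ⟨⟨e, he⟩, hpK, hqK⟩ := hpq
    cases e with
    | inl i =>
      have he' : ends₁ i = s(p, q) := he
      exact ih.tail ⟨⟨i, by simp only [he', Sym2.map_mk]⟩,
        fun h => hpK (mem_clus_pair_iff.2 h), fun h => hqK (mem_clus_pair_iff.2 h)⟩
    | inr k =>
      have he' : s(u, v) = s(p, q) := he
      have hpq' : (if p = v then u else p) = (if q = v then u else q) := by
        rcases Sym2.eq_iff.1 he' with ⟨rfl, rfl⟩ | ⟨rfl, rfl⟩ <;> simp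
      rw [← hpq']
      exact ih

/-- **Regions, backward.**  If `b ∉ K_a` in `G₁ + e_O + e_K`, every vertex projecting into the region
of `π b` in `G₁ / uv` lies in the region of `b` in `G₁ + e_O + e_K`. [this work] -/
theorem region_pair_of_region_contract {b : V}
    (hbK : b ∉ clus (Sum.elim ends₁ (fun _ : Bool => s(u, v))) (Sum.elim ω₁ id) false a) {y : V}
    (hy : y ∈ region (fun i => (ends₁ i).map fun w => if w = v then u else w) ω₁
      (if a = v then u else a) (if b = v then u else b))
    {x : V} (hx : (if x = v then u else x) = y) :
    x ∈ region (Sum.elim ends₁ (fun _ : Bool => s(u, v))) (Sum.elim ω₁ id) a b := by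
  rw [mem_region] at hy ⊢
  -- a partner step across the gadget, available as soon as one end avoids `K_a`
  have partner : ∀ p x, (p = u ∧ x = v) ∨ (p = v ∧ x = u) →
      p ∉ clus (Sum.elim ends₁ (fun _ : Bool => s(u, v))) (Sum.elim ω₁ id) false a →
      x ∈ freeNbr (Sum.elim ends₁ (fun _ : Bool => s(u, v))) (Sum.elim ω₁ id) a p := by
    intro p x hpx hpK
    have hxK : x ∉ clus (Sum.elim ends₁ (fun _ : Bool => s(u, v))) (Sum.elim ω₁ id) false a :=
      fun h => hpK (mem_clus_pair_of_partner h (hpx.symm.imp And.symm And.symm))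
    refine ⟨⟨Sum.inr true, ?_⟩, hpK, hxK⟩
    rcases hpx with ⟨rfl, rfl⟩ | ⟨rfl, rfl⟩
    · rfl
    · exact Sym2.eq_swap
  induction hy generalizing x with
  | refl =>
    rcases proj_eq_iff.1 hx with rfl | hxy
    · exact ReflTransGen.refl
    · exact ReflTransGen.single (partner b x (hxy.symm.imp And.symm And.symm) hbK)
  | @tail y z _ hyz ih =>
    obtain ⟨⟨i, he⟩, hyK, hzK⟩ := hyz
    obtain ⟨p', q', hE⟩ : ∃ p' q', ends₁ i = s(p', q') :=
      Sym2.ind (fun p q => ⟨p, q, rfl⟩) (ends₁ i)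
    have he' : s(if p' = v then u else p', if q' = v then u else q') = s(y, z) := by
      rw [← Sym2.map_mk (fun w => if w = v then u else w), ← hE]; exact he
    have key : ∀ p' q', ends₁ i = s(p', q') → (if p' = v then u else p') = y →
        (if q' = v then u else q') = z →
        ReflTransGen (fun p q => q ∈ freeNbr (Sum.elim ends₁ (fun _ : Bool => s(u, v)))
          (Sum.elim ω₁ id) a p) b x := by
      intro p' q' hE hp' hq'
      have hp : ReflTransGen (fun p q => q ∈ freeNbr (Sum.elim ends₁ (fun _ : Bool => s(u, v)))
          (Sum.elim ω₁ id) a p) b p' := ih hp'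
      have hpK : p' ∉ clus (Sum.elim ends₁ (fun _ : Bool => s(u, v))) (Sum.elim ω₁ id) false a :=
        fun h => hyK (hp' ▸ mem_clus_pair_iff.1 h)
      have hqK : q' ∉ clus (Sum.elim ends₁ (fun _ : Bool => s(u, v))) (Sum.elim ω₁ id) false a :=
        fun h => hzK (hq' ▸ mem_clus_pair_iff.1 h)
      have hq : ReflTransGen (fun p q => q ∈ freeNbr (Sum.elim ends₁ (fun _ : Bool => s(u, v)))
          (Sum.elim ω₁ id) a p) b q' := hp.tail ⟨⟨Sum.inl i, hE⟩, hpK, hqK⟩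
      rcases proj_eq_iff.1 (hq'.trans hx.symm) with rfl | hxy
      · exact hq
      · exact hq.tail (partner q' x hxy hqK)
    rcases Sym2.eq_iff.1 he' with ⟨h1, h2⟩ | ⟨h1, h2⟩
    · exact key p' q' hE h1 h2
    · exact key q' p' (hE.trans Sym2.eq_swap) h2 h1

variable [Fintype ι₁] [DecidableEq ι₁]

/-- The colourings `ω₁ ⊕ id` of `G₁ + e_O + e_K` in `L` are exactly the colourings of `G₁ / uv` in `L`.
[this work] -/
theorem mem_lSet_pair_iff {b c : V} :
    Sum.elim ω₁ id ∈ lSet (Sum.elim ends₁ (fun _ : Bool => s(u, v))) a b c ↔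
      ω₁ ∈ lSet (fun i => (ends₁ i).map fun w => if w = v then u else w)
        (if a = v then u else a) (if b = v then u else b) (if c = v then u else c) := by
  classical
  simp only [lSet, mem_filter, mem_univ, true_and]
  constructor
  · rintro ⟨hOb, hKb, hOc, hKc, hbc⟩
    exact ⟨mem_clus_pair_iff.1 hOb, fun h => hKb (mem_clus_pair_iff.2 h), mem_clus_pair_iff.1 hOc,
      fun h => hKc (mem_clus_pair_iff.2 h), fun h => hbc (region_pair_of_region_contract hKb h rfl)⟩
  · rintro ⟨hOb, hKb, hOc, hKc, hbc⟩
    exact ⟨mem_clus_pair_iff.2 hOb, fun h => hKb (mem_clus_pair_iff.1 h), mem_clus_pair_iff.2 hOc,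
      fun h => hKc (mem_clus_pair_iff.1 h), fun h => hbc (region_contract_of_region_pair h)⟩

/-- The colourings `ω₁ ⊕ id` of `G₁ + e_O + e_K` in `R` are exactly the colourings of `G₁ / uv` in `R`.
[this work] -/
theorem mem_rSet_pair_iff {b c : V} :
    Sum.elim ω₁ id ∈ rSet (Sum.elim ends₁ (fun _ : Bool => s(u, v))) a b c ↔
      ω₁ ∈ rSet (fun i => (ends₁ i).map fun w => if w = v then u else w)
        (if a = v then u else a) (if b = v then u else b) (if c = v then u else c) := by
  classical
  simp only [rSet, mem_filter, mem_univ, true_and]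
  rw [mem_clus_pair_iff, mem_clus_pair_iff, mem_clus_pair_iff, mem_clus_pair_iff]

end Contract

section Reduction

variable {ι₂ : Type*} [Fintype ι₁] [DecidableEq ι₁] [Fintype ι₂] [DecidableEq ι₂]

/-- The `L`-fibre of `G₁ + e_O + e_K` is `L(G₁ / uv)`. [this work] -/
theorem filter_lSet_pair_eq_lSet_contract (ends₁ : ι₁ → Sym2 V) (u v a b c : V) :
    (univ.filter fun ω₁ : ι₁ → Bool =>
      Sum.elim ω₁ id ∈ lSet (Sum.elim ends₁ (fun _ : Bool => s(u, v))) a b c) =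
    lSet (fun i => (ends₁ i).map fun w => if w = v then u else w)
      (if a = v then u else a) (if b = v then u else b) (if c = v then u else c) := by
  classical
  ext ω₁
  rw [mem_filter, mem_lSet_pair_iff]
  exact ⟨fun h => h.2, fun h => ⟨mem_univ _, h⟩⟩

/-- The `R`-fibre of `G₁ + e_O + e_K` is `R(G₁ / uv)`. [this work] -/
theorem filter_rSet_pair_eq_rSet_contract (ends₁ : ι₁ → Sym2 V) (u v a b c : V) :
    (univ.filter fun ω₁ : ι₁ → Bool =>
      Sum.elim ω₁ id ∈ rSet (Sum.elim ends₁ (fun _ : Bool => s(u, v))) a b c) =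
    rSet (fun i => (ends₁ i).map fun w => if w = v then u else w)
      (if a = v then u else a) (if b = v then u else b) (if c = v then u else c) := by
  classical
  ext ω₁
  rw [mem_filter, mem_rSet_pair_iff]
  exact ⟨fun h => h.2, fun h => ⟨mem_univ _, h⟩⟩

/-- **The 2-cut reduction for ANTI₁, contraction form** (memo `KCLUSTER-gen76` §2).  Let
`G = G₁ ∪ G₂` be glued along `{u, v}` (every vertex met by an edge of `G₁` is met by edges of `G₂` only
if it is `u` or `v`; the apex `a` and the terminals `b, c` are met by edges of `G₂` only if they are `u`
or `v`).  If ANTI₁ holds for `G₁`, for `G₁ + uv`, and for the contraction `G₁ / uv` (the system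
`fun i => (ends₁ i).map π`, `π w = if w = v then u else w`, apex `π a`, terminals `π b`, `π c`), then
ANTI₁ holds for `G`.  No hypothesis on `G₂`. [this work] -/
theorem card_lSet_le_card_rSet_of_twoCut' (ends₁ : ι₁ → Sym2 V) (ends₂ : ι₂ → Sym2 V)
    (u v a b c : V)
    (hsep : ∀ w i, w ∈ ends₁ i → ∀ j, w ∈ ends₂ j → w = u ∨ w = v)
    (ha : ∀ j, a ∈ ends₂ j → a = u ∨ a = v) (hb : ∀ j, b ∈ ends₂ j → b = u ∨ b = v)
    (hc : ∀ j, c ∈ ends₂ j → c = u ∨ c = v)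
    (h0 : (lSet ends₁ a b c).card ≤ (rSet ends₁ a b c).card)
    (h1 : (lSet (Sum.elim ends₁ (fun _ : Unit => s(u, v))) a b c).card ≤
      (rSet (Sum.elim ends₁ (fun _ : Unit => s(u, v))) a b c).card)
    (h2 : (lSet (fun i => (ends₁ i).map fun w => if w = v then u else w)
        (if a = v then u else a) (if b = v then u else b) (if c = v then u else c)).card ≤
      (rSet (fun i => (ends₁ i).map fun w => if w = v then u else w)
        (if a = v then u else a) (if b = v then u else b) (if c = v then u else c)).card) :
    (lSet (Sum.elim ends₁ ends₂) a b c).card ≤ (rSet (Sum.elim ends₁ ends₂) a b c).card := by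
  classical
  refine card_lSet_le_card_rSet_of_twoCut ends₁ ends₂ u v a b c hsep ha hb hc h0 h1 ?_
  rw [filter_lSet_pair_eq_lSet_contract, filter_rSet_pair_eq_rSet_contract]
  exact h2

end Reduction

end AntipodalR1

end Summit.CriticalPhenomena.PercolationContinuityZ3.Theorems
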